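import Summits.Ventures.PercRepro.RankLevelSetBiIndepLR

/-! # RankLevelSetBiIndepLRQuot — (LR) FOR EVERY QUOTIENT PAIR: THE CONTAIN-`B` / AVOID-`B` FORM (night-1 g27; dossier §39.4)

For a finite matroid `M` and a set `B ⊆ E` put `aB_k = containCount M B k = #{Q ∈ D_{k + #B} : B ⊆ Q}` and
`bB_k = avoidCount M B k = #{Z ∈ D_k : Z ∩ B = ∅}` — in the language of pairs these are `D_k(M / B, M ∖ B)` and
`D_k(M ∖ B, M / B)`, the marked profiles of the QUOTIENT PAIR `(M ∖ B, M / B)`; for `B = {y}` they are `a_k` and `b_k` of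
`RankLevelSetBiIndepLR`. **(LR)_B** (`BiIndepLRQuot M`, a `Prop`, NOT asserted): for every nonempty `B ⊆ E` the array
`[aB; bB]` is TP2 (`aB_q · bB_p ≤ aB_p · bB_q` for `p ≤ q`). CENSUS (night-1 g27, own exact code): all 383,172 matroids
on 9 elements — `#B = 2`: 6,875,628 `(M, B)` instances, `#B = 3`: 16,029,926 — and all `n ≤ 8`, theta graphs ≤ 16 edges,
random GF(2/3/5) matroids n ≤ 12, series extensions ≤ 13: 0 failures. `containCount_singleton`, `avoidCount_singleton`:
the case `B = {y}`; **`biIndepLR_of_LRQuot : BiIndepLRQuot M → BiIndepLR M`**. So the statement of record for (LR) is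
its quotient-pair form. Nothing here asserts (LR)_B; every declaration has a docstring; imports: the cell's own modules
and Mathlib only. Axioms: standard. -/

namespace PercRepro

open Set Matroid

variable {α : Type} (M : Matroid α) [M.Finite]

omit [M.Finite] in
/-- `aB_k = #{Q ∈ D_{k + #B} : B ⊆ Q}`: the bi-independent sets containing `B`, counted by the size outside `B`. -/
noncomputable def containCount (B : Set α) (k : ℕ) : ℕ := {Q ∈ biIndep M (k + B.ncard) | B ⊆ Q}.ncard

omit [M.Finite] in
/-- `bB_k = #{Z ∈ D_k : Z ∩ B = ∅}`: the bi-independent `k`-sets avoiding `B`. -/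
noncomputable def avoidCount (B : Set α) (k : ℕ) : ℕ := {Z ∈ biIndep M k | Disjoint Z B}.ncard

omit [M.Finite] in
/-- **(LR)_B, the quotient-pair form of (LR)** (a `Prop`, NOT asserted): for every nonempty `B ⊆ E` and all `p ≤ q`,
`aB_q · bB_p ≤ aB_p · bB_q`. -/
def BiIndepLRQuot : Prop :=
  ∀ B : Set α, B ⊆ M.E → B.Nonempty → ∀ p q : ℕ, p ≤ q →
    containCount M B q * avoidCount M B p ≤ containCount M B p * avoidCount M B q

omit [M.Finite] in
/-- For `B = {y}` the contain count is the through-`y` count `a_k`. -/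
lemma containCount_singleton (y : α) (k : ℕ) : containCount M {y} k = yThroughCount M y k := by
  unfold containCount yThroughCount
  rw [Set.ncard_singleton]
  congr 1
  ext Q
  simp only [Set.mem_setOf_eq, Set.singleton_subset_iff]

omit [M.Finite] in
/-- For `B = {y}` the avoid count is the avoid-`y` count `b_k`. -/
lemma avoidCount_singleton (y : α) (k : ℕ) : avoidCount M {y} k = yAvoidCount M y k := by
  unfold avoidCount yAvoidCount
  congr 1
  ext Z
  simp only [Set.mem_setOf_eq, Set.disjoint_singleton_right]

omit [M.Finite] in
/-- **(LR)_B implies (LR)**: the case `B = {y}`. -/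
theorem biIndepLR_of_LRQuot (h : BiIndepLRQuot M) : BiIndepLR M := by
  intro y hy p q hpq
  have := h {y} (Set.singleton_subset_iff.mpr hy) (Set.singleton_nonempty y) p q hpq
  rwa [containCount_singleton, containCount_singleton, avoidCount_singleton, avoidCount_singleton] at this

end PercRepro
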